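import Summits.BirchSwinnertonDyer.BirchSwinnertonDyer.Theorems.KimAtThreeDeepUpperLedger
import HarnessLib

/-!
# Route `KimAtThreeKolyvagin` (rung W2), crux `DeepUpperAtThree`: the SUPPLY ledger at a good core
# vertex — `ord_p δ̃_n = ord_p a′ − t` (pure algebra in `ℤ/p^K`, witness currency)

Cell `bsd-addord`, seat `bsd-addord-w2-c3` (D-0074 row B6), item `stmt-BirchSwinnertonDyer-19076`.
Companion of `KimAtThreeDeepUpperLedger` (the upper ledger `#Sel_{p^K}(E/ℚ) ∣ p^{t+v−α}` at the
empty level, `α = ord_p a′` the index of Kato's Kolyvagin system in the free rank-one module of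
Kolyvagin systems). Crux 19076 in the `∂`-currency is certificate SUPPLY
(`KimAtThreeKolyvaginDeepLowerOfCertificate.deepUpperAtThree_of_certificateSupply`): at every depth a
cyclic level whose Kurihara number has `ord_p ≤ ∂⁽⁰⁾ − ord_p #Ш(p)`. On the Kato side the supply
comes from the SAME scalar `a′` read at a GOOD CORE VERTEX `n` of depth `K` (memo
`kim3/KIM3-PROOF.md` §5 Step 6): a level where the Kolyvagin-system module evaluates bijectively onto
`H¹_{𝓕_can(n)}(ℚ, E[p^K]) ≅ ℤ/p^K` (Sakamoto Thm. 4.4 (1), second clause) and the dictionary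
functional `Λ_n ∘ loc_p` is INJECTIVE on that group (`Sel_{BK(n)}(E[p^K]) = 0`, one more Chebotarev
prime, memo Step 6 (c)). There `z_n = a′ • g_n` with `g_n` a generator and the dictionary value
`Λ_n(loc z_n) = u · p^t · δ̃_n` force `ord_p δ̃_n = α − t` EXACTLY:

* `SupplyLedger.isUnit_of_addOrderOf_eq_pow` — an element of `ℤ/p^K` of additive order `p^K` is a
  unit; `SupplyLedger.isUnit_apply_of_injOn_of_addOrderOf_eq` — hence an additive map to `ℤ/p^K`
  injective on a subgroup sends an element of order `p^K` of that subgroup to a unit;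
* **`SupplyLedger.exists_eq_pow_mul_unit_of_goodCoreVertex`** — with `L` (`= Λ_n ∘ loc_p`)
  injective on `H` (`= H¹_{𝓕_can(n)}`), `g ∈ H` of order `p^K`, `z = (p^α · b) • g` (`p ∤ b`),
  `L z = u · p^t · δ` and `α < K`: `t ≤ α` and `δ = p^{α−t} · (unit)`;
* `SupplyLedger.not_pow_dvd_of_goodCoreVertex` — so `δ ∉ (p^{α−t+1})`: a CERTIFICATE of depth
  `α − t + 1` at the vertex; with the upper ledger's `ord_p #Sel_{p^K} ≤ t + v − α` this is depth
  `≥ v − ord_p #Sel_{p^K} + 1 − …`, i.e. exactly the depth `∂⁽⁰⁾ − ord_p #Ш(p) + 1` that crux 19076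
  asks for (`SupplyLedger.certificateDepth_of_upperLedger`, arithmetic only).

Everything here is pure algebra over an abelian group with an additive map to `ℤ/p^K` (n1011's
`Ledger` style); the Galois-cohomological instances (the level-`n` Selmer group, the port's `Λ_n`,
the scalar transport `z = a′ • g` between levels) are the consumer's witnesses. TOOL theorems; no
definition, no named fact, nothing asserted about any curve.
[cite: Kim2022StructureSelmer, Thm. 1.9 (6), Thm. 3.13, Lemma 3.14] [cite: Sakamoto2024, Thm. 4.4 (1) (p. 926)]
[cite: MazurRubin2004, Thm. 5.2.12 (v)] [cite: Kim2025RefinedTNC, Thm 1.1, Lemma 5.2]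
-/

set_option autoImplicit false
-- the Theorems namespace of a single-conjunct summit repeats the summit name by design (D-0017)
set_option linter.dupNamespace false

noncomputable section

open scoped Classical

namespace Summit.BirchSwinnertonDyer.BirchSwinnertonDyer.Theorems.KimAtThreeDeepUpperSupplyLedger

open Summit.BirchSwinnertonDyer.Rank1Residual.GaloisImage
open Summit.BirchSwinnertonDyer.BirchSwinnertonDyer.Theorems

namespace SupplyLedger

variable {p : ℕ} [hp : Fact p.Prime]

/-! ## §1 Units of `ℤ/p^K` from additive orders -/

/-- An element of `ℤ/p^K` of additive order `p^K` is a unit (its residue is prime to `p`). [folklore] -/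
theorem isUnit_of_addOrderOf_eq_pow {K : ℕ} (x : ZMod (p ^ K)) (hx : addOrderOf x = p ^ K) :
    IsUnit x := by
  haveI : NeZero (p ^ K) := ⟨pow_ne_zero K hp.out.ne_zero⟩
  have hxv : ((x.val : ℕ) : ZMod (p ^ K)) = x := ZMod.natCast_zmod_val x
  rw [← hxv] at hx ⊢
  rw [ZMod.addOrderOf_coe _ (NeZero.ne _)] at hx
  -- `p^K / gcd = p^K` forces `gcd = 1`
  have hg : (p ^ K).gcd x.val = 1 := by
    have hpos : 0 < (p ^ K).gcd x.val := Nat.gcd_pos_of_pos_left _ (pow_pos hp.out.pos K)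
    have hle : (p ^ K) / ((p ^ K).gcd x.val) * ((p ^ K).gcd x.val) ≤ p ^ K := Nat.div_mul_le_self _ _
    rw [hx] at hle
    have : (p ^ K).gcd x.val ≤ 1 := by
      by_contra h
      have h2 : 2 ≤ (p ^ K).gcd x.val := by omega
      have : p ^ K * 2 ≤ p ^ K * ((p ^ K).gcd x.val) := Nat.mul_le_mul_left _ h2
      have hpK : 0 < p ^ K := pow_pos hp.out.pos K
      omega
    omega
  rw [ZMod.isUnit_iff_coprime]
  exact Nat.Coprime.symm hg

/-- An additive map `L : G → ℤ/p^K` that is injective on a subgroup `H` sends every `g ∈ H` of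
additive order `p^K` to a unit. (At a good core vertex: `Λ_n ∘ loc_p` is injective on
`H¹_{𝓕_can(n)} ≅ ℤ/p^K`, so the generator's local value is a unit.) [folklore] -/
theorem isUnit_apply_of_injOn_of_addOrderOf_eq {G : Type*} [AddCommGroup G] {K : ℕ}
    (L : G →+ ZMod (p ^ K)) (H : AddSubgroup G) (hinj : ∀ x ∈ H, L x = 0 → x = 0)
    {g : G} (hg : g ∈ H) (hord : addOrderOf g = p ^ K) : IsUnit (L g) := by
  apply isUnit_of_addOrderOf_eq_pow
  -- `L` restricted to `H` is injective, so it preserves additive orders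
  let L' : H →+ ZMod (p ^ K) := L.comp H.subtype
  have hinj' : Function.Injective L' := by
    intro a b hab
    have h0 : L (a - b : H) = 0 := by
      change L' (a - b) = 0
      rw [map_sub, hab, sub_self]
    have := hinj _ (a - b).2 h0
    exact Subtype.ext (sub_eq_zero.mp (by exact_mod_cast this))
  have h1 : addOrderOf (L' ⟨g, hg⟩) = addOrderOf (⟨g, hg⟩ : H) := addOrderOf_injective L' hinj' _
  have h2 : addOrderOf (⟨g, hg⟩ : H) = addOrderOf g :=
    (addOrderOf_injective H.subtype Subtype.coe_injective ⟨g, hg⟩).symm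
  change addOrderOf (L' ⟨g, hg⟩) = p ^ K
  rw [h1, h2, hord]

/-! ## §2 The supply at a good core vertex -/

/-- **`ord_p δ̃_n = α − t` at a good core vertex.** `G` an abelian group (`H¹(ℚ, E[p^K])`),
`L : G → ℤ/p^K` additive (`Λ_n ∘ loc_p`), `H ≤ G` (`H¹_{𝓕_can(n)}`) on which `L` is injective,
`g ∈ H` of additive order `p^K` (the generator's class at the vertex), Kato's class `z = (p^α b) • g`
with `p ∤ b` and `α < K`, and the dictionary value `L z = u · p^t · δ` (`u` a unit). Then `t ≤ α`
and `δ = p^{α−t} · (unit)`. [cite: Kim2022StructureSelmer, Thm. 3.13 and Lemma 3.14]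
[cite: MazurRubin2004, Thm. 5.2.12 (v)] -/
theorem exists_eq_pow_mul_unit_of_goodCoreVertex {G : Type*} [AddCommGroup G] {K : ℕ}
    (L : G →+ ZMod (p ^ K)) (H : AddSubgroup G) (hinj : ∀ x ∈ H, L x = 0 → x = 0)
    {g : G} (hg : g ∈ H) (hord : addOrderOf g = p ^ K)
    {z : G} {α b : ℕ} (hb : ¬ p ∣ b) (hαK : α < K) (hz : z = (p ^ α * b) • g)
    {t : ℕ} (u : (ZMod (p ^ K))ˣ) {δ : ZMod (p ^ K)}
    (hdict : L z = (u : ZMod (p ^ K)) * (p : ZMod (p ^ K)) ^ t * δ) :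
    t ≤ α ∧ ∃ w : (ZMod (p ^ K))ˣ, δ = ((p ^ (α - t) : ℕ) : ZMod (p ^ K)) * (w : ZMod (p ^ K)) := by
  haveI : NeZero (p ^ K) := ⟨pow_ne_zero K hp.out.ne_zero⟩
  obtain ⟨wg, hwg⟩ := isUnit_apply_of_injOn_of_addOrderOf_eq L H hinj hg hord
  -- the unit `b · wg`
  have hbcop : Nat.Coprime b (p ^ K) :=
    Nat.Coprime.pow_right K ((Nat.Prime.coprime_iff_not_dvd hp.out).2 hb).symm
  set ub : (ZMod (p ^ K))ˣ := ZMod.unitOfCoprime b hbcop with hub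
  have hubval : (ub : ZMod (p ^ K)) = (b : ZMod (p ^ K)) := ZMod.coe_unitOfCoprime b hbcop
  -- `p^t · (u δ) = p^α · (b wg)`
  have hval : ((p ^ t : ℕ) : ZMod (p ^ K)) * ((u : ZMod (p ^ K)) * δ) =
      ((p ^ α : ℕ) : ZMod (p ^ K)) * ((ub * wg : (ZMod (p ^ K))ˣ) : ZMod (p ^ K)) := by
    have h1 : L z = ((p ^ α * b : ℕ) : ZMod (p ^ K)) * (wg : ZMod (p ^ K)) := by
      rw [hz, map_nsmul, nsmul_eq_mul, hwg]
    rw [hdict] at h1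
    rw [Units.val_mul, hubval]
    push_cast at h1 ⊢
    linear_combination h1
  obtain ⟨htα, w', hw'⟩ :=
    KimAtThreeDeepUpperLedger.DeepLedgerUpper.exists_eq_pow_sub_mul_unit hαK _ (ub * wg) hval
  refine ⟨htα, u⁻¹ * w', ?_⟩
  calc δ = ((u⁻¹ : (ZMod (p ^ K))ˣ) : ZMod (p ^ K)) * ((u : ZMod (p ^ K)) * δ) := by
          rw [← mul_assoc, Units.inv_mul, one_mul]
    _ = ((p ^ (α - t) : ℕ) : ZMod (p ^ K)) * ((u⁻¹ * w' : (ZMod (p ^ K))ˣ) : ZMod (p ^ K)) := by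
          rw [hw', Units.val_mul]; ring

/-- **The certificate at the vertex**: under the same hypotheses `δ ∉ (p^{α−t+1})` in `ℤ/p^K` —
a Kurihara-number certificate of depth `α − t + 1` at the good core vertex.
[cite: Kim2022StructureSelmer, Thm. 1.9 (6) and §1.5.1] -/
theorem not_pow_dvd_of_goodCoreVertex {G : Type*} [AddCommGroup G] {K : ℕ}
    (L : G →+ ZMod (p ^ K)) (H : AddSubgroup G) (hinj : ∀ x ∈ H, L x = 0 → x = 0)
    {g : G} (hg : g ∈ H) (hord : addOrderOf g = p ^ K)
    {z : G} {α b : ℕ} (hb : ¬ p ∣ b) (hαK : α < K) (hz : z = (p ^ α * b) • g)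
    {t : ℕ} (u : (ZMod (p ^ K))ˣ) {δ : ZMod (p ^ K)}
    (hdict : L z = (u : ZMod (p ^ K)) * (p : ZMod (p ^ K)) ^ t * δ) :
    ¬ ((p ^ (α - t + 1) : ℕ) : ZMod (p ^ K)) ∣ δ := by
  obtain ⟨htα, w, hw⟩ := exists_eq_pow_mul_unit_of_goodCoreVertex L H hinj hg hord hb hαK hz u hdict
  rw [hw]
  intro hdvd
  have h' : ((p ^ (α - t + 1) : ℕ) : ZMod (p ^ K)) ∣ ((p ^ (α - t) : ℕ) : ZMod (p ^ K)) := by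
    have := hdvd.mul_right ((w⁻¹ : (ZMod (p ^ K))ˣ) : ZMod (p ^ K))
    rwa [mul_assoc, Units.mul_inv, mul_one] at this
  rw [Ledger.pow_dvd_natCast_iff (by omega)] at h'
  have h2 : p ^ (α - t) < p ^ (α - t + 1) := Nat.pow_lt_pow_right hp.out.one_lt (by omega)
  exact absurd (Nat.le_of_dvd (pow_pos hp.out.pos _) h') (not_le.mpr h2)

/-! ## §3 Reading against the upper ledger (arithmetic only) -/

omit hp in
/-- **The supplied certificate has the depth crux 19076 asks for.** If `#Sel_{p^K} = p^s` with
`s ≤ t + v − α` (the upper ledger `#Sel_{p^K} ∣ p^{t+v−α}`) and the vertex certificate has depth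
`α − t + 1` with `t ≤ α ≤ t + v`, then `α − t ≤ v − s`, i.e. the certificate depth `α − t + 1` is at
most `v − s + 1` — in the `∂`-currency (`v = ∂⁽⁰⁾(δ̃)`, `s = ord_p #Ш(p)` at a deep level) this is a
certificate of depth `∂⁽⁰⁾ − ord_p #Ш(p) + 1` (or shallower), the SUPPLY of
`deepUpper_conclusion_iff_certificateSupply`. [cite: Kim2025RefinedTNC, Thm 1.1] -/
theorem certificateDepth_of_upperLedger {s t v α : ℕ} (hs : s ≤ t + v - α) (htα : t ≤ α)
    (hα : α ≤ t + v) : α - t ≤ v - s ∧ s ≤ v := by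
  omega

end SupplyLedger

end Summit.BirchSwinnertonDyer.BirchSwinnertonDyer.Theorems.KimAtThreeDeepUpperSupplyLedger

end
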